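import Summits.Ventures.PercRepro.TriangleCapEightD

/-!
# PercRepro — the triangle cap at nullity `8`: `P(8) = 13`, PART E — the closure spread (p3, gen 22)

`H = cl X`, `Y = E ∖ H`, and `F = cl (insert y₀ H)` for a point `y₀ ∈ Y`. A triangle with two points in `F`
lies in `F`; a triangle through `y ∈ Y` with exactly one point in `H` («type a») therefore drags its other
`Y`-point into `F` once `y ∈ F`. When every point of `Y` lies on exactly three triangles, at most one triangle
avoids `H` altogether and `y₀` lies on none, the set `Z = Y ∖ F` is empty as soon as `|Y| ≤ 6`: `Z ≠ ∅` would
give `|Z| ≥ 3` (a point of `Z` and two type-a partners inside `Z`) while `|Y ∩ F| ≥ 4` (`y₀` and its three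
partners). Hence `Y ⊆ F` (`subset_closure_insert_of_spread`).

Axioms: standard.
-/

open scoped Matroid

namespace PercRepro

namespace TriangleCap

open Set Finset

open scoped Classical

variable {α : Type}

/-- Four pairwise distinct members of a finite set give `4 ≤ ncard`. -/
theorem four_le_ncard_of_distinct {S : Set α} (hS : S.Finite) {a b c d : α}
    (ha : a ∈ S) (hb : b ∈ S) (hc : c ∈ S) (hd : d ∈ S)
    (hab : a ≠ b) (hac : a ≠ c) (had : a ≠ d) (hbc : b ≠ c) (hbd : b ≠ d) (hcd : c ≠ d) : 4 ≤ S.ncard := by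
  have hsub : ({a, b, c, d} : Set α) ⊆ S := by
    intro z hz
    simp only [Set.mem_insert_iff, Set.mem_singleton_iff] at hz
    rcases hz with rfl | rfl | rfl | rfl
    · exact ha
    · exact hb
    · exact hc
    · exact hd
  have h4 : ({a, b, c, d} : Set α).ncard = 4 := by
    rw [Set.ncard_insert_of_notMem (by simp [hab, hac, had]) (Set.toFinite _),
      Set.ncard_insert_of_notMem (by simp [hbc, hbd]) (Set.toFinite _),
      Set.ncard_pair hcd]
  rw [← h4]
  exact Set.ncard_le_ncard hsub hS

/-- The other point of a two-point set. -/
theorem exists_other_of_ncard_two {S : Set α} (h2 : S.ncard = 2) {z : α} (hz : z ∈ S) :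
    ∃ z' ∈ S, z' ≠ z := by
  obtain ⟨p, q, hpq, rfl⟩ := Set.ncard_eq_two.1 h2
  simp only [Set.mem_insert_iff, Set.mem_singleton_iff] at hz
  rcases hz with rfl | rfl
  · exact ⟨q, by simp, hpq.symm⟩
  · exact ⟨p, by simp, hpq⟩

/-- Every triangle through a point outside `H = cl X` has `|T ∩ H| ∈ {0, 1}`. -/
theorem ncard_inter_of_mem_diff (M : Matroid α) [M.Finite] {X : Set α}
    (hF1 : ∀ T ∈ ThmN.triangles M, ∀ a ∈ T, ∀ b ∈ T, a ≠ b → a ∈ M.closure X → b ∈ M.closure X →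
      T ⊆ M.closure X)
    {y : α} (hy : y ∈ M.E \ M.closure X) {T : Set α} (hT : T ∈ ThmN.trianglesThrough M y) :
    (T ∩ M.closure X).ncard = 0 ∨ (T ∩ M.closure X).ncard = 1 := by
  have hT' : T ∈ ThmN.triangles M := ⟨hT.1, hT.2.1⟩
  rcases ncard_inter_mem M hF1 hT' with h | h | h
  · exact Or.inl h
  · exact Or.inr h
  · exact absurd (subset_of_ncard_inter_eq_three M hT' h hT.2.2) hy.2

/-- **The spread step**: a type-a triangle through a point `w ∈ Y ∩ F` lies in `F = cl (insert y₀ H)`. -/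
theorem triangle_subset_of_spread (M : Matroid α) [M.Finite] {X : Set α} {y₀ : α}
    (hy₀ : y₀ ∈ M.E \ M.closure X) {w : α} (hw : w ∈ M.E \ M.closure X)
    (hwF : w ∈ M.closure (insert y₀ (M.closure X))) {T : Set α} (hT : T ∈ ThmN.trianglesThrough M w)
    (h1 : (T ∩ M.closure X).ncard = 1) : T ⊆ M.closure (insert y₀ (M.closure X)) := by
  have hHF : M.closure X ⊆ M.closure (insert y₀ (M.closure X)) := fun z hz =>
    M.subset_closure (insert y₀ (M.closure X))
      (Set.insert_subset hy₀.1 (M.closure_subset_ground X)) (Set.mem_insert_of_mem _ hz)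
  obtain ⟨u, hu⟩ := Set.ncard_eq_one.1 h1
  have huT : u ∈ T ∩ M.closure X := by rw [hu]; simp
  have hwu : w ≠ u := fun h => hw.2 (h ▸ huT.2)
  exact triangle_subset_closure_of_two_mem M ⟨hT.1, hT.2.1⟩ hT.2.2 huT.1 hwu hwF (hHF huT.2)

/-- A type-a triangle through `z ∈ Y ∖ F` has its other `Y`-point outside `F` as well. -/
theorem exists_other_of_not_mem (M : Matroid α) [M.Finite] {X : Set α}
    {y₀ : α} (hy₀ : y₀ ∈ M.E \ M.closure X) {z : α} (hz : z ∈ M.E \ M.closure X)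
    (hzF : z ∉ M.closure (insert y₀ (M.closure X))) {T : Set α} (hT : T ∈ ThmN.trianglesThrough M z)
    (h1 : (T ∩ M.closure X).ncard = 1) :
    ∃ z' ∈ T ∩ (M.E \ M.closure X), z' ≠ z ∧ z' ∉ M.closure (insert y₀ (M.closure X)) := by
  have hT' : T ∈ ThmN.triangles M := ⟨hT.1, hT.2.1⟩
  have h2 : (T ∩ (M.E \ M.closure X)).ncard = 2 := by
    have := ncard_inter_add M (H := M.closure X) hT'
    omega
  obtain ⟨z', hz', hne⟩ := exists_other_of_ncard_two h2 ⟨hT.2.2, hz⟩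
  refine ⟨z', hz', hne, fun hz'F => hzF ?_⟩
  have hTz' : T ∈ ThmN.trianglesThrough M z' := ⟨hT.1, hT.2.1, hz'.1⟩
  exact triangle_subset_of_spread M hy₀ hz'.2 hz'F hTz' h1 hT.2.2

/-- **The closure spread.** With `H = cl X`, `Y = E ∖ H`, `y₀ ∈ Y` and `F = cl (insert y₀ H)`: if every
point of `Y` lies on exactly `3` triangles, at most one triangle avoids `H`, `y₀` lies on no such triangle and
`|Y| ≤ 6`, then `Y ⊆ F`. -/
theorem subset_closure_insert_of_spread (M : Matroid α) [M.Finite]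
    (hC1 : ∀ L ⊆ M.E, M.eRk L = 2 → L.ncard ≤ 3)
    (𝒯 : Finset (Set α)) (h𝒯 : ∀ T, T ∈ 𝒯 ↔ T ∈ ThmN.triangles M) {X : Set α}
    (hF1 : ∀ T ∈ ThmN.triangles M, ∀ a ∈ T, ∀ b ∈ T, a ≠ b → a ∈ M.closure X → b ∈ M.closure X →
      T ⊆ M.closure X)
    (hdeg : ∀ y ∈ M.E \ M.closure X, (ThmN.trianglesThrough M y).ncard = 3)
    (hb : (𝒯.filter (fun T => (T ∩ M.closure X).ncard = 0)).card ≤ 1)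
    {y₀ : α} (hy₀ : y₀ ∈ M.E \ M.closure X)
    (hy₀b : ∀ T ∈ ThmN.trianglesThrough M y₀, (T ∩ M.closure X).ncard ≠ 0)
    (hY6 : (M.E \ M.closure X).ncard ≤ 6) :
    M.E \ M.closure X ⊆ M.closure (insert y₀ (M.closure X)) := by
  have hYfin : (M.E \ M.closure X).Finite := M.ground_finite.subset Set.sdiff_subset
  have hy₀F : y₀ ∈ M.closure (insert y₀ (M.closure X)) :=
    M.subset_closure (insert y₀ (M.closure X))
      (Set.insert_subset hy₀.1 (M.closure_subset_ground X)) (Set.mem_insert _ _)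
  -- (c) a point of `Y ∖ F` forces `|Y ∖ F| ≥ 3`
  have hZ3 : ∀ z ∈ M.E \ M.closure X, z ∉ M.closure (insert y₀ (M.closure X)) →
      3 ≤ ((M.E \ M.closure X) \ M.closure (insert y₀ (M.closure X))).ncard := by
    intro z hz hzF
    have hdz := hdeg z hz
    rw [ncard_trianglesThrough_eq_card_filter M 𝒯 h𝒯 z] at hdz
    have hsplit := Finset.card_filter_add_card_filter_not (s := 𝒯.filter (fun T => z ∈ T))
      (fun T => (T ∩ M.closure X).ncard = 1)
    have hsub : (𝒯.filter (fun T => z ∈ T)).filter (fun T => ¬ (T ∩ M.closure X).ncard = 1) ⊆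
        𝒯.filter (fun T => (T ∩ M.closure X).ncard = 0) := by
      intro T hT
      simp only [Finset.mem_filter] at hT ⊢
      refine ⟨hT.1.1, ?_⟩
      have hTz : T ∈ ThmN.trianglesThrough M z :=
        ⟨((h𝒯 T).1 hT.1.1).1, ((h𝒯 T).1 hT.1.1).2, hT.1.2⟩
      rcases ncard_inter_of_mem_diff M hF1 hz hTz with h | h
      · exact h
      · exact absurd h hT.2
    have hle := Finset.card_le_card hsub
    have h2 : 1 < ((𝒯.filter (fun T => z ∈ T)).filter (fun T => (T ∩ M.closure X).ncard = 1)).card := by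
      omega
    obtain ⟨T₁, hT₁, T₂, hT₂, hne⟩ := Finset.one_lt_card.1 h2
    simp only [Finset.mem_filter] at hT₁ hT₂
    have hT₁z : T₁ ∈ ThmN.trianglesThrough M z :=
      ⟨((h𝒯 T₁).1 hT₁.1.1).1, ((h𝒯 T₁).1 hT₁.1.1).2, hT₁.1.2⟩
    have hT₂z : T₂ ∈ ThmN.trianglesThrough M z :=
      ⟨((h𝒯 T₂).1 hT₂.1.1).1, ((h𝒯 T₂).1 hT₂.1.1).2, hT₂.1.2⟩
    obtain ⟨z₁, hz₁, hz₁z, hz₁F⟩ := exists_other_of_not_mem M hy₀ hz hzF hT₁z hT₁.2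
    obtain ⟨z₂, hz₂, hz₂z, hz₂F⟩ := exists_other_of_not_mem M hy₀ hz hzF hT₂z hT₂.2
    have hz₁₂ : z₁ ≠ z₂ := by
      intro h
      have hint := ThmN.inter_eq_singleton_of_mem_trianglesThrough M hC1 hT₁z hT₂z hne
      have : z₁ ∈ T₁ ∩ T₂ := ⟨hz₁.1, h ▸ hz₂.1⟩
      rw [hint, Set.mem_singleton_iff] at this
      exact hz₁z this
    have hfin : ((M.E \ M.closure X) \ M.closure (insert y₀ (M.closure X))).Finite :=
      hYfin.subset Set.sdiff_subset
    exact (Set.two_lt_ncard hfin).2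
      ⟨z, ⟨hz, hzF⟩, z₁, ⟨hz₁.2, hz₁F⟩, z₂, ⟨hz₂.2, hz₂F⟩, hz₁z.symm, hz₂z.symm, hz₁₂⟩
  -- (d) `y₀` and its three partners: `|Y ∩ F| ≥ 4`
  have hW4 : 4 ≤ ((M.E \ M.closure X) ∩ M.closure (insert y₀ (M.closure X))).ncard := by
    obtain ⟨T₁, T₂, T₃, h12, h13, h23, hLset⟩ := Set.ncard_eq_three.1 (hdeg y₀ hy₀)
    have h1 : T₁ ∈ ThmN.trianglesThrough M y₀ := by rw [hLset]; simp
    have h2 : T₂ ∈ ThmN.trianglesThrough M y₀ := by rw [hLset]; simp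
    have h3 : T₃ ∈ ThmN.trianglesThrough M y₀ := by rw [hLset]; simp
    have ha : ∀ T ∈ ThmN.trianglesThrough M y₀, (T ∩ M.closure X).ncard = 1 := by
      intro T hT
      rcases ncard_inter_of_mem_diff M hF1 hy₀ hT with h | h
      · exact absurd h (hy₀b T hT)
      · exact h
    have hpart : ∀ T ∈ ThmN.trianglesThrough M y₀, ∃ w ∈ T ∩ (M.E \ M.closure X), w ≠ y₀ ∧
        w ∈ M.closure (insert y₀ (M.closure X)) := by
      intro T hT
      have hT' : T ∈ ThmN.triangles M := ⟨hT.1, hT.2.1⟩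
      have h2' : (T ∩ (M.E \ M.closure X)).ncard = 2 := by
        have := ncard_inter_add M (H := M.closure X) hT'
        have := ha T hT
        omega
      obtain ⟨w, hw, hne⟩ := exists_other_of_ncard_two h2' ⟨hT.2.2, hy₀⟩
      exact ⟨w, hw, hne, triangle_subset_of_spread M hy₀ hy₀ hy₀F hT (ha T hT) hw.1⟩
    obtain ⟨w₁, hw₁, hw₁y, hw₁F⟩ := hpart T₁ h1
    obtain ⟨w₂, hw₂, hw₂y, hw₂F⟩ := hpart T₂ h2
    obtain ⟨w₃, hw₃, hw₃y, hw₃F⟩ := hpart T₃ h3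
    have hdist : ∀ {T T' : Set α}, T ∈ ThmN.trianglesThrough M y₀ → T' ∈ ThmN.trianglesThrough M y₀ →
        T ≠ T' → ∀ {w w'}, w ∈ T → w' ∈ T' → w ≠ y₀ → w = w' → False := by
      intro T T' hT hT' hne w w' hw hw' hwy hww'
      have hint := ThmN.inter_eq_singleton_of_mem_trianglesThrough M hC1 hT hT' hne
      have : w ∈ T ∩ T' := ⟨hw, hww' ▸ hw'⟩
      rw [hint, Set.mem_singleton_iff] at this
      exact hwy this
    exact four_le_ncard_of_distinct (hYfin.subset Set.inter_subset_left)
      ⟨hy₀, hy₀F⟩ ⟨hw₁.2, hw₁F⟩ ⟨hw₂.2, hw₂F⟩ ⟨hw₃.2, hw₃F⟩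
      hw₁y.symm hw₂y.symm hw₃y.symm
      (fun h => hdist h1 h2 h12 hw₁.1 hw₂.1 hw₁y h)
      (fun h => hdist h1 h3 h13 hw₁.1 hw₃.1 hw₁y h)
      (fun h => hdist h2 h3 h23 hw₂.1 hw₃.1 hw₂y h)
  -- (e) `|Y ∩ F| + |Y ∖ F| = |Y| ≤ 6`
  have hsum := Set.ncard_inter_add_ncard_sdiff_eq_ncard (M.E \ M.closure X)
    (M.closure (insert y₀ (M.closure X))) hYfin
  intro z hz
  by_contra hzF
  have := hZ3 z hz hzF
  omega

end TriangleCap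

end PercRepro
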